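import Literature.MeasureTheory.RandomSets.MeasurableSelection

/-!
# Measurable argmin over countably many compact pieces (companions of the Kuratowski–Ryll-Nardzewski theorem)

Topic `Literature/MeasureTheory/RandomSets` — a companion of `MeasurableSelection` (the Kuratowski–Ryll-Nardzewski theorem
`exists_measurable_selector`: NON-EMPTY CLOSED values in a Polish space, OPEN-hitting measurability; and measurable argmax ∕ argmin for ONE
correspondence with CLOSED GRAPH and a jointly continuous objective).  Pure Mathlib + that file; the selection step below IS that theorem,
cited by name, not re-proved.

Let `X` be a measurable space and `Y` a topological space.  `Φ : X → Set Y` is HIT-MEASURABLE (`IsHitMeasurable`, the «measurable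
multi-function» of [RobinsonRodrigoSadowskiCUP2016] App. E) if `Φ⁻¹(F) = {x | Φ x ∩ F ≠ ∅}` is measurable for every CLOSED `F ⊆ Y`.
This file adds to the KRN file what a constrained minimisation with a DISCONTINUOUS constraint map needs:

* §1 `IsHitMeasurable` and its elementary closure properties ((E.1) of loc. cit.);
* §2 `measurable_sInf_image` — for `Φ` COMPACT-valued hit-measurable and `φ : Y → ℝ` continuous the value function `x ↦ min_{Φ x} φ` is measurable,
  and `isHitMeasurable_argminCorr` — the argmin correspondence is again compact-valued and hit-measurable (the measurable maximum theorem
  [AliprantisBorder2006] Thm 18.19, compact case, through the two value functions `min_{Φ x ∩ F} φ ≤ min_{Φ x} φ`);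
* §3 `exists_measurable_selector_of_isClosed` — KRN with EMPTY VALUES ALLOWED: a closed-valued hit-measurable `Φ` into a Polish space admits a
  measurable `f` with `f x ∈ Φ x` wherever `Φ x ≠ ∅` and `f x = y₀` elsewhere (the empty locus is measurable; `exists_measurable_selector` applied
  to `Φ` completed by `Y` off its domain);
* §4 `exists_measurable_selector_iUnion` — countably many closed-valued pieces: a measurable selector of their union (first non-empty piece);
  `exists_measurable_argmin_selector_iUnion` — **for `D n` compact-valued hit-measurable (`n : ℕ`) and `S` continuous, a measurable map which,
  at every `x` where `S` attains its infimum over `⋃ n, D n x`, is such a minimiser** (pieces `{y ∈ D n x | S y ≤ S on ⋃ m, D m x}`).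
  The argmin over a union is not the union of the argmins and a countable union of closed-graph pieces has no closed graph, so the
  closed-graph theorem `exists_measurable_argmin_selector` of the KRN file does not apply to such unions; the value-function route does.

Use: the (2.12) background-field minimisation of [Balaban1988Convergent] p. 256 (`Node00/Record12MinimiserSelection`), whose constraint map
— the exp-mean-log block averaging — is continuous only on the members of a countable closed cover (`MeasurableConstrainedArgmin`).
HONEST FRAMING: textbook measure theory, kernel-checked; nothing of Bałaban's series is asserted here; no carrier of record is touched.
-/

noncomputable section

open Set _root_.MeasureTheory _root_.TopologicalSpace

namespace Literature.MeasureTheory.RandomSets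

variable {X Y : Type*}

/-! ## §1 Closed-hitting measurability of a correspondence -/

section Hit
variable [MeasurableSpace X] [TopologicalSpace Y]

/-- A correspondence `Φ : X → Set Y` is HIT-MEASURABLE («measurable multi-function» of [RobinsonRodrigoSadowskiCUP2016] App. E p. 301) if
for every closed `F ⊆ Y` the set `Φ⁻¹(F) = {x | Φ x ∩ F ≠ ∅}` is measurable (for compact-valued `Φ` into a separable metrisable space this is
weak measurability, [AliprantisBorder2006] Lemma 18.2). [cite: RobinsonRodrigoSadowskiCUP2016, App. E p.301 (definition)] -/
def IsHitMeasurable (Φ : X → Set Y) : Prop :=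
  ∀ F : Set Y, IsClosed F → MeasurableSet {x | (Φ x ∩ F).Nonempty}

namespace IsHitMeasurable
variable {Φ : X → Set Y}

/-- The domain `{x | Φ x ≠ ∅}` of a hit-measurable correspondence is measurable (`F = Y`). [cite: RobinsonRodrigoSadowskiCUP2016, App. E p.301 (definition)] -/
theorem measurableSet_nonempty (h : IsHitMeasurable Φ) : MeasurableSet {x | (Φ x).Nonempty} := by
  simpa only [inter_univ] using h univ isClosed_univ

/-- Intersecting the values with a fixed closed set `B` preserves hit-measurability (`(Φ ∩ B)⁻¹(A) = Φ⁻¹(A ∩ B)`, the device (E.1)).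
[cite: RobinsonRodrigoSadowskiCUP2016, (E.1) p.302] -/
theorem inter_closed (h : IsHitMeasurable Φ) {C : Set Y} (hC : IsClosed C) : IsHitMeasurable fun x => Φ x ∩ C :=
  fun F hF => by simpa only [inter_assoc] using h (C ∩ F) (hC.inter hF)

/-- In a (pseudo)metrisable space hit-measurability for closed sets gives it for OPEN sets (an open set is a countable union of closed sets) —
the weak measurability the Kuratowski–Ryll-Nardzewski theorem consumes. [cite: RobinsonRodrigoSadowskiCUP2016, App. E p.302 (remark before Thm E.1)] -/
theorem measurableSet_inter_isOpen [PseudoMetrizableSpace Y] (h : IsHitMeasurable Φ) {U : Set Y} (hU : IsOpen U) :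
    MeasurableSet {x | (Φ x ∩ U).Nonempty} := by
  letI : PseudoMetricSpace Y := TopologicalSpace.pseudoMetrizableSpacePseudoMetric Y
  obtain ⟨F, hFcl, -, hFU, -⟩ := hU.exists_iUnion_isClosed
  rw [← hFU]
  simp only [inter_iUnion, nonempty_iUnion, setOf_exists]
  exact MeasurableSet.iUnion fun n => h _ (hFcl n)

end IsHitMeasurable

end Hit

/-! ## §2 The value function and the argmin correspondence over compact values -/

section Argmin
variable {Φ : X → Set Y} {φ : Y → ℝ}

/-- The ARGMIN correspondence of `φ` over `Φ`: the minimisers of `φ` on the value `Φ x`. [cite: AliprantisBorder2006, Thm 18.19 p.605] -/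
def argminCorr (Φ : X → Set Y) (φ : Y → ℝ) (x : X) : Set Y :=
  {y | y ∈ Φ x ∧ ∀ z ∈ Φ x, φ y ≤ φ z}

/-- Minimisers lie in the value. [folklore] -/
private theorem argminCorr_subset (x : X) : argminCorr Φ φ x ⊆ Φ x := fun _ hy => hy.1

variable [TopologicalSpace Y]

/-- Over a non-empty compact set the infimum of a continuous function is attained: `sInf (φ '' K) = φ y` for a minimiser `y`. [folklore] -/
private theorem exists_sInf_image_eq {K : Set Y} (hK : IsCompact K) (hne : K.Nonempty) (hφ : Continuous φ) :
    ∃ y ∈ K, sInf (φ '' K) = φ y ∧ ∀ z ∈ K, φ y ≤ φ z := by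
  obtain ⟨y, hy, hmin⟩ := hK.exists_isMinOn hne hφ.continuousOn
  have hmin' : ∀ z ∈ K, φ y ≤ φ z := fun z hz => isMinOn_iff.mp hmin z hz
  refine ⟨y, hy, le_antisymm ?_ ?_, hmin'⟩
  · exact csInf_le (hK.bddBelow_image hφ.continuousOn) (mem_image_of_mem φ hy)
  · exact le_csInf (hne.image φ) (by rintro _ ⟨z, hz, rfl⟩; exact hmin' z hz)

/-- The argmin of a continuous function over a compact value is compact. [cite: AliprantisBorder2006, Thm 18.19 p.605] -/
theorem isCompact_argminCorr {x : X} (hc : IsCompact (Φ x)) (hφ : Continuous φ) : IsCompact (argminCorr Φ φ x) := by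
  have hcl : IsClosed {y | ∀ z ∈ Φ x, φ y ≤ φ z} := by
    simp only [setOf_forall]
    exact isClosed_iInter fun z => isClosed_iInter fun _ => isClosed_le hφ continuous_const
  exact hc.inter_right hcl

/-- The argmin over a non-empty compact value is non-empty. [cite: AliprantisBorder2006, Thm 18.19 p.605] -/
theorem argminCorr_nonempty {x : X} (hc : IsCompact (Φ x)) (hne : (Φ x).Nonempty) (hφ : Continuous φ) :
    (argminCorr Φ φ x).Nonempty := by
  obtain ⟨y, hy, -, hmin⟩ := exists_sInf_image_eq hc hne hφ
  exact ⟨y, hy, hmin⟩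

variable [MeasurableSpace X]

/-- **The value function is measurable**: for `Φ` compact-valued and hit-measurable and `φ` continuous, `x ↦ min_{Φ x} φ`
(`sInf (φ '' Φ x)`, junk `0` on the empty value) is measurable — `{min ≤ t} = {Φ x meets the closed set φ ≤ t}`. [cite: AliprantisBorder2006, Thm 18.19 p.605] -/
theorem measurable_sInf_image (hc : ∀ x, IsCompact (Φ x)) (hm : IsHitMeasurable Φ) (hφ : Continuous φ) :
    Measurable fun x => sInf (φ '' Φ x) := by
  refine measurable_of_Iic fun t => ?_
  have key : (fun x => sInf (φ '' Φ x)) ⁻¹' Iic t =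
      ({x | (Φ x).Nonempty} ∩ {x | (Φ x ∩ φ ⁻¹' Iic t).Nonempty}) ∪ ({x | (Φ x).Nonempty}ᶜ ∩ {_x | (0 : ℝ) ≤ t}) := by
    ext x
    simp only [mem_preimage, mem_Iic, mem_union, mem_inter_iff, mem_setOf_eq, mem_compl_iff]
    by_cases hx : (Φ x).Nonempty
    · obtain ⟨y, hy, hyeq, hmin⟩ := exists_sInf_image_eq (hc x) hx hφ
      constructor
      · intro h
        exact Or.inl ⟨hx, y, hy, show φ y ≤ t by rwa [hyeq] at h⟩
      · rintro (⟨-, z, hz, hzt⟩ | ⟨hnx, -⟩)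
        · exact (csInf_le ((hc x).bddBelow_image hφ.continuousOn) (mem_image_of_mem φ hz)).trans hzt
        · exact absurd hx hnx
    · have hempty : Φ x = ∅ := not_nonempty_iff_eq_empty.mp hx
      simp [hempty, Real.sInf_empty]
  rw [key]
  exact (hm.measurableSet_nonempty.inter (hm _ (isClosed_Iic.preimage hφ))).union
    (hm.measurableSet_nonempty.compl.inter (MeasurableSet.const _))

/-- **The argmin correspondence is hit-measurable** (measurable maximum theorem, compact case): `argmin ∩ F ≠ ∅` iff `Φ x ∩ F ≠ ∅` and
`min_{Φ x ∩ F} φ ≤ min_{Φ x} φ`, two measurable value functions. [cite: AliprantisBorder2006, Thm 18.19 p.605] -/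
theorem isHitMeasurable_argminCorr (hc : ∀ x, IsCompact (Φ x)) (hm : IsHitMeasurable Φ) (hφ : Continuous φ) :
    IsHitMeasurable (argminCorr Φ φ) := by
  intro F hF
  have key : {x | (argminCorr Φ φ x ∩ F).Nonempty} =
      {x | (Φ x ∩ F).Nonempty} ∩ {x | sInf (φ '' (Φ x ∩ F)) ≤ sInf (φ '' Φ x)} := by
    ext x
    simp only [mem_setOf_eq, mem_inter_iff]
    constructor
    · rintro ⟨y, ⟨hyΦ, hmin⟩, hyF⟩
      refine ⟨⟨y, hyΦ, hyF⟩, ?_⟩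
      calc sInf (φ '' (Φ x ∩ F)) ≤ φ y :=
            csInf_le (((hc x).inter_right hF).bddBelow_image hφ.continuousOn) ⟨y, ⟨hyΦ, hyF⟩, rfl⟩
        _ ≤ sInf (φ '' Φ x) :=
            le_csInf (Set.Nonempty.image φ ⟨y, hyΦ⟩) (by rintro _ ⟨z, hz, rfl⟩; exact hmin z hz)
    · rintro ⟨hne, hle⟩
      obtain ⟨y, ⟨hyΦ, hyF⟩, hyeq, -⟩ := exists_sInf_image_eq ((hc x).inter_right hF) hne hφ
      refine ⟨y, ⟨hyΦ, fun z hz => ?_⟩, hyF⟩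
      calc φ y = sInf (φ '' (Φ x ∩ F)) := hyeq.symm
        _ ≤ sInf (φ '' Φ x) := hle
        _ ≤ φ z := csInf_le ((hc x).bddBelow_image hφ.continuousOn) ⟨z, hz, rfl⟩
  rw [key]
  exact (hm F hF).inter (measurableSet_le
    (measurable_sInf_image (fun x => (hc x).inter_right hF) (hm.inter_closed hF) hφ) (measurable_sInf_image hc hm hφ))

end Argmin

/-! ## §3 Kuratowski–Ryll-Nardzewski with empty values allowed -/

section Selection
variable [MeasurableSpace X] [TopologicalSpace Y] [PolishSpace Y] [MeasurableSpace Y] [BorelSpace Y]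

/-- **MEASURABLE SELECTION WITH A DEFAULT** (Kuratowski–Ryll-Nardzewski, `exists_measurable_selector` of the sibling file, applied to `Φ`
completed by the whole space off its domain): a CLOSED-valued, possibly EMPTY-valued, hit-measurable correspondence into a Polish space
admits a measurable `f` with `f x ∈ Φ x` wherever `Φ x ≠ ∅` and `f x = y₀` elsewhere (the empty locus is measurable).
[cite: Kechris1995, Theorem 12.13] -/
theorem exists_measurable_selector_of_isClosed (Φ : X → Set Y) (hcl : ∀ x, IsClosed (Φ x)) (hm : IsHitMeasurable Φ) (y₀ : Y) :
    ∃ f : X → Y, Measurable f ∧ (∀ x, (Φ x).Nonempty → f x ∈ Φ x) ∧ (∀ x, ¬ (Φ x).Nonempty → f x = y₀) := by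
  classical
  have hD : MeasurableSet {x | (Φ x).Nonempty} := hm.measurableSet_nonempty
  let Φ' : X → Set Y := fun x => if (Φ x).Nonempty then Φ x else univ
  have hne' : ∀ x, (Φ' x).Nonempty := fun x => by
    by_cases hx : (Φ x).Nonempty
    · simpa only [Φ', if_pos hx] using hx
    · simp only [Φ', if_neg hx]
      exact ⟨y₀, mem_univ _⟩
  have hcl' : ∀ x, IsClosed (Φ' x) := fun x => by
    by_cases hx : (Φ x).Nonempty
    · simpa only [Φ', if_pos hx] using hcl x
    · simp only [Φ', if_neg hx, isClosed_univ]
  have hmeas' : ∀ U : Set Y, IsOpen U → MeasurableSet {x | (Φ' x ∩ U).Nonempty} := by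
    intro U hU
    have e : {x | (Φ' x ∩ U).Nonempty} =
        ({x | (Φ x).Nonempty} ∩ {x | (Φ x ∩ U).Nonempty}) ∪ ({x | (Φ x).Nonempty}ᶜ ∩ {_x | U.Nonempty}) := by
      ext x
      by_cases hx : (Φ x).Nonempty
      · simp [Φ', hx]
      · simp [Φ', hx]
    rw [e]
    exact (hD.inter (hm.measurableSet_inter_isOpen hU)).union (hD.compl.inter (MeasurableSet.const _))
  obtain ⟨g, hgm, hg⟩ := exists_measurable_selector Φ' hne' hcl' hmeas'
  refine ⟨fun x => if (Φ x).Nonempty then g x else y₀, Measurable.ite hD hgm measurable_const, fun x hx => ?_,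
    fun x hx => by simp only [if_neg hx]⟩
  have hgx := hg x
  simp only [Φ', if_pos hx] at hgx
  simpa only [if_pos hx] using hgx

/-! ## §4 Countably many pieces; argmin over countably many compact pieces -/

/-- **Countably many pieces**: closed-valued hit-measurable correspondences `Φ n`, `n : ℕ`, admit a measurable map selecting a point of
`⋃ n, Φ n x` whenever that union is non-empty (default value elsewhere) — first non-empty piece, then its selector. [cite: Kechris1995, Theorem 12.13] -/
theorem exists_measurable_selector_iUnion (Φ : ℕ → X → Set Y) (hcl : ∀ n x, IsClosed (Φ n x))
    (hm : ∀ n, IsHitMeasurable (Φ n)) (y₀ : Y) :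
    ∃ f : X → Y, Measurable f ∧ (∀ x, (⋃ n, Φ n x).Nonempty → f x ∈ ⋃ n, Φ n x) ∧
      (∀ x, ¬ (⋃ n, Φ n x).Nonempty → f x = y₀) := by
  classical
  choose f hfm hfin hfout using fun n => exists_measurable_selector_of_isClosed (Φ n) (hcl n) (hm n) y₀
  let p : ℕ → X → Prop := fun n x => (Φ n x).Nonempty ∨ ∀ m, ¬ (Φ m x).Nonempty
  have hp : ∀ n, MeasurableSet {x | p n x} := by
    intro n
    have e : {x | p n x} = {x | (Φ n x).Nonempty} ∪ ⋂ m, {x | (Φ m x).Nonempty}ᶜ := by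
      ext x; simp [p, mem_iInter]
    rw [e]
    exact (hm n).measurableSet_nonempty.union (MeasurableSet.iInter fun m => (hm m).measurableSet_nonempty.compl)
  have hex : ∀ x, ∃ n, p n x := fun x => by
    by_cases h : ∃ m, (Φ m x).Nonempty
    · obtain ⟨m, hm'⟩ := h
      exact ⟨m, Or.inl hm'⟩
    · exact ⟨0, Or.inr (not_exists.mp h)⟩
  refine ⟨fun x => f (Nat.find (hex x)) x, Measurable.find hfm hp hex, fun x hx => ?_, fun x hx => ?_⟩
  · obtain ⟨y, hy⟩ := hx
    obtain ⟨m, hym⟩ := mem_iUnion.mp hy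
    have hn : (Φ (Nat.find (hex x)) x).Nonempty :=
      (Nat.find_spec (hex x)).resolve_right fun h => h m ⟨y, hym⟩
    exact mem_iUnion.mpr ⟨_, hfin _ x hn⟩
  · refine hfout _ x fun h => hx ?_
    obtain ⟨y, hy⟩ := h
    exact ⟨y, mem_iUnion.mpr ⟨_, hy⟩⟩

/-- **MEASURABLE ARGMIN OVER COUNTABLY MANY COMPACT PIECES.**  `D n` compact-valued hit-measurable, `S` continuous: there is a measurable `f`
which, at every `x` where `S` attains its infimum over `⋃ n, D n x`, is such a minimiser, and equals the default `y₀` at every other `x`.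
(The pieces `A n x = {y ∈ D n x | S y ≤ S on ⋃ m, D m x}` are compact-valued and hit-measurable by the value functions of §2; then §4's
first-non-empty-piece selector.)  The measurable maximum theorem for a countable union of compact-valued pieces.
[cite: AliprantisBorder2006, Thm 18.19 p.605] -/
theorem exists_measurable_argmin_selector_iUnion (D : ℕ → X → Set Y) (hc : ∀ n x, IsCompact (D n x))
    (hm : ∀ n, IsHitMeasurable (D n)) {S : Y → ℝ} (hS : Continuous S) (y₀ : Y) :
    ∃ f : X → Y, Measurable f ∧
      (∀ x, (∃ y ∈ ⋃ n, D n x, ∀ z ∈ ⋃ n, D n x, S y ≤ S z) →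
        f x ∈ ⋃ n, D n x ∧ ∀ z ∈ ⋃ n, D n x, S (f x) ≤ S z) ∧
      (∀ x, ¬ (∃ y ∈ ⋃ n, D n x, ∀ z ∈ ⋃ n, D n x, S y ≤ S z) → f x = y₀) := by
  let A : ℕ → X → Set Y := fun n x => {y | y ∈ D n x ∧ ∀ z ∈ ⋃ m, D m x, S y ≤ S z}
  have hAc : ∀ n x, IsCompact (A n x) := by
    intro n x
    have hcl : IsClosed {y | ∀ z ∈ ⋃ m, D m x, S y ≤ S z} := by
      simp only [setOf_forall]
      exact isClosed_iInter fun z => isClosed_iInter fun _ => isClosed_le hS continuous_const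
    exact (hc n x).inter_right hcl
  have hAm : ∀ n, IsHitMeasurable (A n) := by
    intro n F hF
    have key : {x | (A n x ∩ F).Nonempty} = {x | (D n x ∩ F).Nonempty} ∩
        ⋂ m, ({x | (D m x).Nonempty}ᶜ ∪ {x | sInf (S '' (D n x ∩ F)) ≤ sInf (S '' D m x)}) := by
      ext x
      simp only [mem_setOf_eq, mem_inter_iff, mem_iInter, mem_union, mem_compl_iff]
      constructor
      · rintro ⟨y, ⟨hyD, hmin⟩, hyF⟩
        refine ⟨⟨y, hyD, hyF⟩, fun m => ?_⟩
        by_cases hm' : (D m x).Nonempty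
        · refine Or.inr ?_
          calc sInf (S '' (D n x ∩ F)) ≤ S y :=
                csInf_le (((hc n x).inter_right hF).bddBelow_image hS.continuousOn) ⟨y, ⟨hyD, hyF⟩, rfl⟩
            _ ≤ sInf (S '' D m x) :=
                le_csInf (hm'.image S) (by rintro _ ⟨z, hz, rfl⟩; exact hmin z (mem_iUnion.mpr ⟨m, hz⟩))
        · exact Or.inl hm'
      · rintro ⟨hne, hall⟩
        obtain ⟨y, ⟨hyD, hyF⟩, hyeq, -⟩ := exists_sInf_image_eq ((hc n x).inter_right hF) hne hS
        refine ⟨y, ⟨hyD, fun z hz => ?_⟩, hyF⟩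
        obtain ⟨m, hzm⟩ := mem_iUnion.mp hz
        have hle : sInf (S '' (D n x ∩ F)) ≤ sInf (S '' D m x) := (hall m).resolve_left fun h => h ⟨z, hzm⟩
        calc S y = sInf (S '' (D n x ∩ F)) := hyeq.symm
          _ ≤ sInf (S '' D m x) := hle
          _ ≤ S z := csInf_le ((hc m x).bddBelow_image hS.continuousOn) ⟨z, hzm, rfl⟩
    rw [key]
    exact ((hm n) F hF).inter (MeasurableSet.iInter fun m => ((hm m).measurableSet_nonempty.compl).union
      (measurableSet_le (measurable_sInf_image (fun x => (hc n x).inter_right hF) ((hm n).inter_closed hF) hS)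
        (measurable_sInf_image (hc m) (hm m) hS)))
  obtain ⟨f, hfm, hfin, hfout⟩ := exists_measurable_selector_iUnion A (fun n x => (hAc n x).isClosed) hAm y₀
  have hAU : ∀ x y, y ∈ (⋃ n, A n x) ↔ y ∈ (⋃ n, D n x) ∧ ∀ z ∈ ⋃ n, D n x, S y ≤ S z := by
    intro x y
    constructor
    · intro hy
      obtain ⟨n, hyn⟩ := mem_iUnion.mp hy
      exact ⟨mem_iUnion.mpr ⟨n, hyn.1⟩, hyn.2⟩
    · rintro ⟨hy, hmin⟩
      obtain ⟨n, hyn⟩ := mem_iUnion.mp hy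
      exact mem_iUnion.mpr ⟨n, hyn, hmin⟩
  refine ⟨f, hfm, fun x hx => ?_, fun x hx => ?_⟩
  · obtain ⟨y, hy, hmin⟩ := hx
    have hne : (⋃ n, A n x).Nonempty := ⟨y, (hAU x y).mpr ⟨hy, hmin⟩⟩
    exact (hAU x (f x)).mp (hfin x hne)
  · refine hfout x fun h => hx ?_
    obtain ⟨y, hy⟩ := h
    exact ⟨y, ((hAU x y).mp hy).1, ((hAU x y).mp hy).2⟩

end Selection

end Literature.MeasureTheory.RandomSets
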